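import Literature.IUT.HodgeArakelov.EtaleThetaDataOfSettingCuspidalGenerators
import Literature.AnabelianGeometry.EtaleTheta.Discharge.Sec2InertiaOntoDeltaTheta
import HarnessLib

/-!
# [IUTchII] Cor. 2.5 (i), residual J1 at the GENUINE Prop. 1.4 output: the generator hypothesis `hgen` FROM
# THE COMMUTATOR AXIS — abc-iut-w4-d024's reduction (p434999) composed with the [EtTh] §2 p. 35 discharge
# (p435890); for the CONSTRUCTED `X̲̲` the commutator-axis clause is the ONLY input (proof-only, 0 definitions)

S. Mochizuki, *Inter-universal Teichmüller theory II*, kurims manuscript (Dec. 2020), §2, Cor. 2.5 (i) p. 71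
l. 33–37, proof p. 72 l. 35–38 («follows immediately by considering the cuspidal inertia groups involved»)
[claim: Mochizuki2012, status: disputed] (IUTchII §2 Cor 2.5 (i), kurims p.71); S. Mochizuki, *The étale theta
function …*, Publ. RIMS **45** (2009) [EtTh], §1 p. 12 («`Δ_X` … a profinite free group on `2` generators»,
«`Δ_Θ := [Δ^Θ_X, Δ^Θ_X] (≅ Ẑ(1))`»), §2 p. 35 («`D_x → Π^Θ_X` … maps the inertia group `I_x ⊆ D_x` isomorphically
onto `Δ_Θ`»), Def. 2.5 (i) p. 39 / Def. 2.7 p. 41 (the covering `X̲̲` of type `(1, (ℤ/lℤ)^Θ)`)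
[cite: MochizukiEtTh2009, Def 2.1 p.35]. abc-iut cell, layer L6/L2 junction, node **IUTchII:Cor2.5(i)**,
residual J1 = GAP-LEDGER **G-w4d005g4-1**, RE-LABELLED by abc-iut-L6-lead (NODES v3.4am) «interface junction
G-L2t10-3-family (cusp position), L2-side»; seat abc-iut-w5-d165 (gen 4), sequel BY NAME to abc-iut-w4-d024 (gen 5).

WHAT IS COMPOSED. p434999 (`EtaleThetaDataOfSettingCuspidalGenerators`, abc-iut-w4-d024) proves p431116's
`hgen : (top).map ε = (bot).map ε ⊔ ⨆ t, J t` at the genuine bridge datum `etaleThetaDataOfSetting'`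
(`lDeltaTheta := lDeltaSubquotient C = φ⁻¹(l·Δ_Θ)/Ker φ`, `φ = toTheta∣_{Π^tp_X̲̲}`) MODULO two [EtTh]-level binders:
`hx : toTheta(I_x) = Δ_Θ` (position of the cusp's inertia in `Δ_X`) and `hker : Ker toTheta ≤ Π^tp_{X̲̲}`.
p435890 (`EtaleTheta/Discharge/Sec2InertiaOntoDeltaTheta`, this seat) proves `hx` from the COMMUTATOR-AXIS clause
«`toHat(I_x) = ⟨[a,b]⟩⁻` for a topological generating pair `a, b` of `Δ_X`» (the v-next §1 interface clause of
record, GAP-LEDGER l.273 — `ThetaSetting.map_toTheta_inertia_eq_deltaTheta_of_commutatorAxis`, via the integral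
class-two identity `[Δ_X,Δ_X]⁻ = ⟨[a,b]⟩⁻ · [[Δ_X,Δ_X],Δ_X]⁻`) and proves `hker` outright for abc-iut-L2-t7's
CONSTRUCTED choice `X̲̲ = Ξ.doubleUnderline` (`XuuCocycleData.ker_toTheta_le_Huu`). Hence, BY NAME:

* §1 `map_phi_inertia_inf_eq_lDeltaTheta_of_commutatorAxis` / `…conj…`: the clause «`φ(I ∩ Π^tp_{X̲̲}) = l·Δ_Θ`»
  for `I = I_x` and for EVERY conjugate `γ I_x γ⁻¹` (all the cusps of `X̲̲`), from the commutator axis + `hker`;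
* §2 **`lDeltaSubquotient_top_eq_bot_sup_inertia_of_commutatorAxis`**, **`…_iSup_conj_inertia_…`** (the whole
  conjugate family `{Π^tp_{X̲̲} ∩ γ_t I_x γ_t⁻¹}_t`), **`etaleThetaDataOfSetting'_hgen_of_commutatorAxis`** (the
  consumer's pushed-forward shape, any `ε`, any family containing one `I_x ∩ Π^tp_{X̲̲}`): `hgen` from the
  commutator-axis clause + `hker`;
* §3 at the constructed `X̲̲` (`C := Ξ.doubleUnderline`): **`lDeltaSubquotient_top_eq_bot_sup_inertia_ofCocycle`**,
  **`etaleThetaDataOfSetting'_hgen_ofCocycle_of_commutatorAxis`**, **`etaleThetaDataOfSetting'_cor25i_ofCocycle…`** —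
  `hgen` and Cor. 2.5 (i)'s conclusion with the commutator-axis clause as the ONLY [EtTh]-level input.

NET (D-0067 currency): residual J1 of IUTchII:Cor2.5(i) at the genuine Prop. 1.4 output over the constructed `X̲̲` =
ONE v-next §1 interface clause «the cusp's inertia is the commutator axis `⟨[a,b]⟩⁻`» (G-L2t10-3 family) — a
reduction, not a discharge: no model in the tree has a commutator-axis cusp (abc-iut-w5-d037 gen 8, D-row
09:09:30Z; the χ-model's synthetic cusp is toral). No new `def`, no new `Prop` fact, zero edit of any other seat's
file; nothing of the series or of [EtTh] is asserted; no side is taken on [IUTchIII] Cor. 3.12; typed ≠ proved.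
-/

noncomputable section

namespace Literature.IUT.HodgeArakelov

namespace EtaleThetaDataOfSetting

open Literature.AnabelianGeometry.EtaleTheta
open scoped Pointwise commutatorElement

variable {p : ℕ} [Fact p.Prime] {D : Literature.AnabelianGeometry.EtaleTheta.ThetaSetting p}
  {E : D.EtaleThetaData} {l : ℕ} (C : E.DoubleUnderline l)

/-! ### 1. The clause from the commutator axis -/

/-- **«`φ(I_x ∩ Π^tp_{X̲̲}) = l·Δ_Θ`» from the commutator axis**: for a cusp `x` of `X` whose inertia lies on the
commutator axis (`toHat(I_x) = ⟨[a,b]⟩⁻`, `a, b` a topological generating pair of `Δ_X`) and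
`Ker toTheta ≤ Π^tp_{X̲̲}`. [cite: MochizukiEtTh2009, Def 2.1 p.35] -/
theorem map_phi_inertia_inf_eq_lDeltaTheta_of_commutatorAxis (x : D.Pt) {a b : D.DeltaHat}
    (hdense : (Subgroup.closure ({a, b} : Set D.DeltaHat)).topologicalClosure = ⊤)
    (hIx : (D.inertia x).map D.toHat.toMonoidHom =
      (Subgroup.zpowers (⁅(a : D.PiHat), (b : D.PiHat)⁆)).topologicalClosure)
    (hker : D.toTheta.ker ≤ C.Huu) :
    ((D.inertia x ⊓ C.Huu).subgroupOf C.Huu : Subgroup (Pi C)).map (phi C) = D.lDeltaTheta l :=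
  map_phi_inertia_inf_eq_lDeltaTheta C x (D.map_toTheta_inertia_eq_deltaTheta_of_commutatorAxis x hdense hIx) hker

/-- The same for EVERY conjugate `γ I_x γ⁻¹` (`γ ∈ Π^tp_X`): all the cuspidal inertia groups `Π^tp_{X̲̲} ∩ γ I_x γ⁻¹`
of `X̲̲` map onto `l·Δ_Θ`. [cite: MochizukiEtTh2009, Def 2.1 p.35] -/
theorem map_phi_conj_inertia_inf_eq_lDeltaTheta_of_commutatorAxis (x : D.Pt) {a b : D.DeltaHat}
    (hdense : (Subgroup.closure ({a, b} : Set D.DeltaHat)).topologicalClosure = ⊤)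
    (hIx : (D.inertia x).map D.toHat.toMonoidHom =
      (Subgroup.zpowers (⁅(a : D.PiHat), (b : D.PiHat)⁆)).topologicalClosure)
    (hker : D.toTheta.ker ≤ C.Huu) (γ : D.PiTemp) :
    ((MulAut.conj γ • D.inertia x ⊓ C.Huu).subgroupOf C.Huu : Subgroup (Pi C)).map (phi C) = D.lDeltaTheta l :=
  map_phi_inf_eq_lDeltaTheta C _
    (D.map_toTheta_conj_eq_deltaTheta (D.map_toTheta_inertia_eq_deltaTheta_of_commutatorAxis x hdense hIx) γ)
    hker

/-! ### 2. `hgen` from the commutator axis -/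

/-- **Single-cusp `hgen` from the commutator axis**: the top group of the genuine `(l·Δ_Θ)(Π^tp_{X̲̲})` is generated
over its bottom group by `I_x ∩ Π^tp_{X̲̲}`. [claim: Mochizuki2012, status: disputed] (IUTchII §2 Cor 2.5 (i), kurims p.71) -/
theorem lDeltaSubquotient_top_eq_bot_sup_inertia_of_commutatorAxis (x : D.Pt) {a b : D.DeltaHat}
    (hdense : (Subgroup.closure ({a, b} : Set D.DeltaHat)).topologicalClosure = ⊤)
    (hIx : (D.inertia x).map D.toHat.toMonoidHom =
      (Subgroup.zpowers (⁅(a : D.PiHat), (b : D.PiHat)⁆)).topologicalClosure)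
    (hker : D.toTheta.ker ≤ C.Huu) :
    (lDeltaSubquotient C).top =
      (lDeltaSubquotient C).bot ⊔ ((D.inertia x ⊓ C.Huu).subgroupOf C.Huu : Subgroup (Pi C)) :=
  lDeltaSubquotient_top_eq_bot_sup_inertia C x (D.map_toTheta_inertia_eq_deltaTheta_of_commutatorAxis x hdense hIx)
    hker

/-- **Conjugate-family `hgen` from the commutator axis**: for any nonempty family of conjugators `γ_t ∈ Π^tp_X`,
the top group of `(l·Δ_Θ)(Π^tp_{X̲̲})` is generated over its bottom group by the cuspidal inertia groups
`Π^tp_{X̲̲} ∩ γ_t I_x γ_t⁻¹` of `X̲̲` — print's «the cuspidal inertia groups involved».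
[claim: Mochizuki2012, status: disputed] (IUTchII §2 Cor 2.5 (i), kurims p.71) -/
theorem lDeltaSubquotient_top_eq_bot_sup_iSup_conj_inertia_of_commutatorAxis (x : D.Pt) {a b : D.DeltaHat}
    (hdense : (Subgroup.closure ({a, b} : Set D.DeltaHat)).topologicalClosure = ⊤)
    (hIx : (D.inertia x).map D.toHat.toMonoidHom =
      (Subgroup.zpowers (⁅(a : D.PiHat), (b : D.PiHat)⁆)).topologicalClosure)
    (hker : D.toTheta.ker ≤ C.Huu) {ι : Sort*} [Nonempty ι] (γ : ι → D.PiTemp) :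
    (lDeltaSubquotient C).top = (lDeltaSubquotient C).bot ⊔
      ⨆ t, ((MulAut.conj (γ t) • D.inertia x ⊓ C.Huu).subgroupOf C.Huu : Subgroup (Pi C)) := by
  obtain ⟨t₀⟩ := ‹Nonempty ι›
  refine lDeltaSubquotient_top_eq_bot_sup_iSup C _
    (fun t => (map_phi_conj_inertia_inf_eq_lDeltaTheta_of_commutatorAxis C x hdense hIx hker (γ t)).le) ?_
  calc D.lDeltaTheta l
      = ((MulAut.conj (γ t₀) • D.inertia x ⊓ C.Huu).subgroupOf C.Huu : Subgroup (Pi C)).map (phi C) :=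
        (map_phi_conj_inertia_inf_eq_lDeltaTheta_of_commutatorAxis C x hdense hIx hker (γ t₀)).symm
    _ ≤ ⨆ t, ((MulAut.conj (γ t) • D.inertia x ⊓ C.Huu).subgroupOf C.Huu : Subgroup (Pi C)).map (phi C) :=
        le_iSup (fun t => ((MulAut.conj (γ t) • D.inertia x ⊓ C.Huu).subgroupOf C.Huu :
          Subgroup (Pi C)).map (phi C)) t₀

/-- **The consumer's `hgen` for `etaleThetaDataOfSetting'` from the commutator axis**: abc-iut-w4-d024's
`etaleThetaDataOfSetting'_hgen_of_cuspPosition` with its cusp-position binder `hx` DISCHARGED by the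
commutator-axis clause (p435890). [claim: Mochizuki2012, status: disputed] (IUTchII §2 Cor 2.5 (i), kurims p.71) -/
theorem etaleThetaDataOfSetting'_hgen_of_commutatorAxis (hC : D.Compat) (hS : D.Sec2Hyps)
    (hchar : PiYddCharacteristic C) (S : ThetaSetting.{0}) (eS : (Pi C) ≃ₜ* S.PiX) (hl : S.l = l)
    {Q : Type*} [Group Q] (ε : Pi C →* Q) {ι : Sort*} (I : ι → Subgroup (Pi C)) (J : ι → Subgroup Q)
    (hIJ : ∀ t, (I t).map ε = J t) (hle : ∀ t, (I t).map (phi C) ≤ D.lDeltaTheta l)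
    (x : D.Pt) {a b : D.DeltaHat}
    (hdense : (Subgroup.closure ({a, b} : Set D.DeltaHat)).topologicalClosure = ⊤)
    (hIx : (D.inertia x).map D.toHat.toMonoidHom =
      (Subgroup.zpowers (⁅(a : D.PiHat), (b : D.PiHat)⁆)).topologicalClosure)
    (hker : D.toTheta.ker ≤ C.Huu)
    (t₀ : ι) (ht₀ : I t₀ = ((D.inertia x ⊓ C.Huu).subgroupOf C.Huu : Subgroup (Pi C))) :
    ((etaleThetaDataOfSetting' C hC hS hchar S eS hl).lDeltaTheta.top).map ε =
      ((etaleThetaDataOfSetting' C hC hS hchar S eS hl).lDeltaTheta.bot).map ε ⊔ ⨆ t, J t :=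
  etaleThetaDataOfSetting'_hgen_of_cuspPosition C hC hS hchar S eS hl ε I J hIJ hle x
    (D.map_toTheta_inertia_eq_deltaTheta_of_commutatorAxis x hdense hIx) hker t₀ ht₀

end EtaleThetaDataOfSetting

/-! ### 3. At the CONSTRUCTED `X̲̲`: the commutator-axis clause is the only input -/

namespace EtaleThetaDataOfSetting

open Literature.AnabelianGeometry.EtaleTheta
open scoped Pointwise commutatorElement

variable {p : ℕ} [Fact p.Prime] {D : Literature.AnabelianGeometry.EtaleTheta.ThetaSetting p}
  {E : D.EtaleThetaData} {l : ℕ} (Ξ : ThetaSetting.EtaleThetaData.XuuCocycleData E l)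

/-- At abc-iut-L2-t7's constructed `X̲̲ = Ξ.doubleUnderline`, the clause «`φ(I_x ∩ Π^tp_{X̲̲}) = l·Δ_Θ`» needs only the
cusp-position binder `hx` (`hker` is p435890's `XuuCocycleData.ker_toTheta_le_Huu`). [cite: MochizukiEtTh2009, Def 2.7 p.41] -/
theorem map_phi_inertia_inf_eq_lDeltaTheta_ofCocycle (x : D.Pt) (hx : (D.inertia x).map D.toTheta = D.DeltaTheta) :
    ((D.inertia x ⊓ Ξ.doubleUnderline.Huu).subgroupOf Ξ.doubleUnderline.Huu :
      Subgroup (Pi Ξ.doubleUnderline)).map (phi Ξ.doubleUnderline) = D.lDeltaTheta l :=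
  map_phi_inertia_inf_eq_lDeltaTheta Ξ.doubleUnderline x hx Ξ.ker_toTheta_le_Huu

/-- **`hgen` at the constructed `X̲̲` from the commutator axis ALONE**: the top group of `(l·Δ_Θ)(Π^tp_{X̲̲})` is
generated over its bottom group by `I_x ∩ Π^tp_{X̲̲}`, for every cusp `x` of `X` with `toHat(I_x) = ⟨[a,b]⟩⁻`.
[claim: Mochizuki2012, status: disputed] (IUTchII §2 Cor 2.5 (i), kurims p.71) -/
theorem lDeltaSubquotient_top_eq_bot_sup_inertia_ofCocycle (x : D.Pt) {a b : D.DeltaHat}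
    (hdense : (Subgroup.closure ({a, b} : Set D.DeltaHat)).topologicalClosure = ⊤)
    (hIx : (D.inertia x).map D.toHat.toMonoidHom =
      (Subgroup.zpowers (⁅(a : D.PiHat), (b : D.PiHat)⁆)).topologicalClosure) :
    (lDeltaSubquotient Ξ.doubleUnderline).top =
      (lDeltaSubquotient Ξ.doubleUnderline).bot ⊔
        ((D.inertia x ⊓ Ξ.doubleUnderline.Huu).subgroupOf Ξ.doubleUnderline.Huu :
          Subgroup (Pi Ξ.doubleUnderline)) :=
  lDeltaSubquotient_top_eq_bot_sup_inertia_of_commutatorAxis Ξ.doubleUnderline x hdense hIx Ξ.ker_toTheta_le_Huu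

/-- **Conjugate-family `hgen` at the constructed `X̲̲` from the commutator axis alone.**
[claim: Mochizuki2012, status: disputed] (IUTchII §2 Cor 2.5 (i), kurims p.71) -/
theorem lDeltaSubquotient_top_eq_bot_sup_iSup_conj_inertia_ofCocycle (x : D.Pt) {a b : D.DeltaHat}
    (hdense : (Subgroup.closure ({a, b} : Set D.DeltaHat)).topologicalClosure = ⊤)
    (hIx : (D.inertia x).map D.toHat.toMonoidHom =
      (Subgroup.zpowers (⁅(a : D.PiHat), (b : D.PiHat)⁆)).topologicalClosure)
    {ι : Sort*} [Nonempty ι] (γ : ι → D.PiTemp) :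
    (lDeltaSubquotient Ξ.doubleUnderline).top = (lDeltaSubquotient Ξ.doubleUnderline).bot ⊔
      ⨆ t, ((MulAut.conj (γ t) • D.inertia x ⊓ Ξ.doubleUnderline.Huu).subgroupOf Ξ.doubleUnderline.Huu :
        Subgroup (Pi Ξ.doubleUnderline)) :=
  lDeltaSubquotient_top_eq_bot_sup_iSup_conj_inertia_of_commutatorAxis Ξ.doubleUnderline x hdense hIx
    Ξ.ker_toTheta_le_Huu γ

/-- **The consumer's `hgen` for `etaleThetaDataOfSetting'` at the constructed `X̲̲`**, commutator axis the ONLY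
[EtTh]-level input. [claim: Mochizuki2012, status: disputed] (IUTchII §2 Cor 2.5 (i), kurims p.71) -/
theorem etaleThetaDataOfSetting'_hgen_ofCocycle_of_commutatorAxis
    (hchar : PiYddCharacteristic Ξ.doubleUnderline) (S : ThetaSetting.{0})
    (eS : (Pi Ξ.doubleUnderline) ≃ₜ* S.PiX) (hl : S.l = l)
    {Q : Type*} [Group Q] (ε : Pi Ξ.doubleUnderline →* Q) {ι : Sort*}
    (I : ι → Subgroup (Pi Ξ.doubleUnderline)) (J : ι → Subgroup Q) (hIJ : ∀ t, (I t).map ε = J t)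
    (hle : ∀ t, (I t).map (phi Ξ.doubleUnderline) ≤ D.lDeltaTheta l)
    (x : D.Pt) {a b : D.DeltaHat}
    (hdense : (Subgroup.closure ({a, b} : Set D.DeltaHat)).topologicalClosure = ⊤)
    (hIx : (D.inertia x).map D.toHat.toMonoidHom =
      (Subgroup.zpowers (⁅(a : D.PiHat), (b : D.PiHat)⁆)).topologicalClosure)
    (t₀ : ι) (ht₀ : I t₀ = ((D.inertia x ⊓ Ξ.doubleUnderline.Huu).subgroupOf Ξ.doubleUnderline.Huu :
      Subgroup (Pi Ξ.doubleUnderline))) :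
    ((etaleThetaDataOfSetting' Ξ.doubleUnderline Ξ.compat Ξ.sec2 hchar S eS hl).lDeltaTheta.top).map ε =
      ((etaleThetaDataOfSetting' Ξ.doubleUnderline Ξ.compat Ξ.sec2 hchar S eS hl).lDeltaTheta.bot).map ε ⊔
        ⨆ t, J t :=
  etaleThetaDataOfSetting'_hgen_of_commutatorAxis Ξ.doubleUnderline Ξ.compat Ξ.sec2 hchar S eS hl ε I J hIJ hle x
    hdense hIx Ξ.ker_toTheta_le_Huu t₀ ht₀

/-- **IUTchII:Cor2.5(i) at the constructed `X̲̲` from the commutator axis**: for every `H ≤ Q` containing the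
`J t` (the consumer's `Π_{v⩒▶}`, Cor. 2.4 (ii) «`I^δ_t ⊆ Π^δ_{v⩒▶}`»), `((top).map ε ⊓ H) ⊔ (bot).map ε = (top).map ε`
— «the inclusion `Π_{v⩒▶} ↪ Π_v` induces an isomorphism `(l·Δ_Θ)(Π_{v⩒▶}) ⥲ (l·Δ_Θ)(Π_v)`», with no `hgen`, `hx` or
`hker` binder. [claim: Mochizuki2012, status: disputed] (IUTchII §2 Cor 2.5 (i), kurims p.71) -/
theorem etaleThetaDataOfSetting'_cor25i_ofCocycle_of_commutatorAxis
    (hchar : PiYddCharacteristic Ξ.doubleUnderline) (S : ThetaSetting.{0})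
    (eS : (Pi Ξ.doubleUnderline) ≃ₜ* S.PiX) (hl : S.l = l)
    {Q : Type*} [Group Q] (ε : Pi Ξ.doubleUnderline →* Q) {ι : Sort*}
    (I : ι → Subgroup (Pi Ξ.doubleUnderline)) (J : ι → Subgroup Q) (hIJ : ∀ t, (I t).map ε = J t)
    (hle : ∀ t, (I t).map (phi Ξ.doubleUnderline) ≤ D.lDeltaTheta l)
    (x : D.Pt) {a b : D.DeltaHat}
    (hdense : (Subgroup.closure ({a, b} : Set D.DeltaHat)).topologicalClosure = ⊤)
    (hIx : (D.inertia x).map D.toHat.toMonoidHom =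
      (Subgroup.zpowers (⁅(a : D.PiHat), (b : D.PiHat)⁆)).topologicalClosure)
    (t₀ : ι) (ht₀ : I t₀ = ((D.inertia x ⊓ Ξ.doubleUnderline.Huu).subgroupOf Ξ.doubleUnderline.Huu :
      Subgroup (Pi Ξ.doubleUnderline)))
    (H : Subgroup Q) (hJH : ∀ t, J t ≤ H) :
    (((etaleThetaDataOfSetting' Ξ.doubleUnderline Ξ.compat Ξ.sec2 hchar S eS hl).lDeltaTheta.top).map ε ⊓ H) ⊔
        ((etaleThetaDataOfSetting' Ξ.doubleUnderline Ξ.compat Ξ.sec2 hchar S eS hl).lDeltaTheta.bot).map ε =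
      ((etaleThetaDataOfSetting' Ξ.doubleUnderline Ξ.compat Ξ.sec2 hchar S eS hl).lDeltaTheta.top).map ε := by
  refine etaleThetaDataOfSetting'_cor25i Ξ.doubleUnderline Ξ.compat Ξ.sec2 hchar S eS hl ε I J hIJ hle ?_ H hJH
  calc D.lDeltaTheta l = (I t₀).map (phi Ξ.doubleUnderline) := by
        rw [ht₀, map_phi_inertia_inf_eq_lDeltaTheta_ofCocycle Ξ x
          (D.map_toTheta_inertia_eq_deltaTheta_of_commutatorAxis x hdense hIx)]
    _ ≤ ⨆ t, (I t).map (phi Ξ.doubleUnderline) := le_iSup (fun t => (I t).map (phi Ξ.doubleUnderline)) t₀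

end EtaleThetaDataOfSetting

end Literature.IUT.HodgeArakelov

end
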